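import Literature.Analysis.Fourier.FejerJacksonKernels
import Literature.MathematicalPhysics.QuantumFieldTheory.Balaban1983to89.T4CouplingMatching

/-!
# Spine/NE4/BlockCovarianceRate — (R59) (R50)'s «θ = L⁻² EXACT» PROVED: the on-axis block covariance of the δ-block-averaged massless lattice field after `m`
# steps is `cB_m(q) = (2 + cos q)∕(12 sin²(q∕2)) + L^{−2m}∕6` — its cutoff-dependence is EXACTLY `L^{−2m}∕6`, so `|cB_{m+1} − cB_m| = (1 − L⁻²)∕6 · (L⁻²)^m`
# (= `2^{−3−2m}` at `L = 2`, the number generation 12 MEASURED to 4 digits with two engines); the mechanism is the fourth moment of the Fejér kernel over the momentum fibre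

Cell `pub-balaban-gaps` (YM blitz G2), seat `ne4`, generation 16 (unit `pub-balaban-gaps-ne4-g16`); record `HOME/ne/NE4.md` §5 (R59).

HONEST FRAMING.  NE4 = `T4CouplingMatching.ScaleShiftRate` is NOT IN PRINT ([Balaban1987RG1] = CMP **109** (1987) p. 264) and NOT proved.  This file is about the cell's own
MODEL (R50) (generation 12; `HOME/pub-balaban-gaps-ne4/g12/R50-RESULTS.md`, engine `r50_engine.py`: massless free scalar, fine spacing `η = L^{−m}`, δ-function block averaging to the
unit lattice), whose «linear (NE2-type) object» `cB_m(q) = Σ_j |u_j|²∕D_j` (fibre `p_j = q + 2πj`, form factor `|u_j|² = sin²(q∕2)∕(M² sin²(p_j∕2M))`, fine symbol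
`D_j = 4M² sin²(p_j∕2M)`, `M = L^m`) was MEASURED to converge at `θ = L⁻²` «EXACTLY» (`r^B_m = max_q |cB_{m+1} − cB_m| = 2^{−3−2m}` at `L = 2`, two float lineages).  Here that
number is DERIVED AND PROVED for momenta along a lattice axis (where the transverse fibre is trivial and the engine's four-dimensional sum IS the one-dimensional one below): pure
trigonometric-sum algebra on the tree's Fejér kernel (`Literature/Analysis/Fourier/FejerJacksonKernels`); NOT Bałaban's propagators, NOT (AF-0r), NOT NE4; no status word
moves (NE4 stays DEPENDENT; spine 0∕9).  One finite T⁴; NOT ℝ⁴, NOT infinite volume, NOT a mass gap, NOT Clay.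

CONTENT (block size `K = M + 1` in the tree's Fejér convention `F_M = |Σ_{j ≤ M} e(jx)|²∕(M+1)`; fibre points `t_j = x₀ + j∕K`, unit momentum `q = 2πK·x₀`).
* §1 CHARACTER ORTHOGONALITY ON THE FIBRE: `Σ_{j<K} e(j·n∕K) = K·[K ∣ n]` (`sum_e_fibre`), `Σ_{j≤M} cos(2πn·t_j) = K cos(2πn x₀)·[K ∣ n]` (`sum_cos_tfib`), `n ∈ ℤ`.
* §2 **THE FOURTH MOMENT OF THE FEJÉR KERNEL OVER THE FIBRE** (`sum_fejer_sq_fibre`): `Σ_{j<K} F_M(t_j)² = K + (M∕3)·((2M+1) + (M+2)·cos q)` — from the tree's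
  cosine-polynomial form of `F_M` (`fejer_eq`), the product formula and §1 (only `h = h′` and `h + h′ = K` survive), and two power sums (`sum_fejerWeights`).
* §3 THE MODEL: `formFactorSq M x₀ j = F_M(t_j)∕K` (= the engine's `|u_j|²`, `formFactorSq_mul_sin_sq`: `· K² sin²(πt_j) = sin²(q∕2)` by the tree's `fejer_mul_sin_sq`),
  `fibreSym M x₀ j = 4K² sin²(πt_j)` (= the engine's `D_j`, (R58)'s `latSym K p_j`), `blockCov M x₀ = Σ_{j<K} formFactorSq∕fibreSym` (= `cB`), and **`blockCov_eq`**: for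
  `sin(q∕2) ≠ 0`, `blockCov M x₀ = (2 + cos q)∕(12 sin²(q∕2)) + 1∕(6K²)`.
* §4 THE RATE: at `K = L^m` (`blockCovScale L m q`), **`blockCovScale_eq`** `= (2 + cos q)∕(12 sin²(q∕2)) + (L⁻²)^m∕6`, hence **`blockCovScale_step`**:
  `blockCovScale L (m+1) q − blockCovScale L m q = −((1 − L⁻²)∕6)·(L⁻²)^m` EXACTLY, `|…| = ((1 − L⁻²)∕6)(L⁻²)^m` (`abs_blockCovScale_step`; at `L = 2`: `(1∕8)·4^{−m} = 2^{−3−2m}`,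
  `abs_blockCovScale_step_two`), the (AF-0r) field shape with `θ = L⁻²`, `c₀ = 1∕6`, limit `(2 + cos q)∕(12 sin²(q∕2))` (`conv_shape_blockCov`) and NE4's own shape
  `ScaleShiftRate ((1 − L⁻²)∕6 · L⁻²) (L⁻²) γ (ofMarkov …)` for the history-free family (`scaleShiftRate_blockCov`).

WHAT THIS SAYS FOR THE ROW (census (R59); words UNCHANGED — DEPENDENT; NOT IN PRINT; NOT PROVED; 0∕9): the cell's one «EXACT» MODEL rate datum (R50) moves from «float, two
lineages» to KERNEL with its constant and mechanism: the `η²`-term `L^{−2m}∕6` is the ALIASING (`h + h′ = K`) part of the fourth moment of the block form factor, q-INDEPENDENT along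
the axis (whence the exactly geometric `max_q`); with (R57)∕(R58) every `L⁻²` the row quotes is now a kernel statement in its model.  NOT Bałaban's propagators (rows NE2∕NE3).
-/

noncomputable section

namespace Summit.QuantumFields.BalabanUV.T4Continuum.Spine.NE4

open Real Finset
open Literature.Analysis.Fourier.TrigApprox (e e_add e_nat_mul e_int norm_e fejer fejer_eq fejer_mul_sin_sq fejer_nonneg)
open Literature.MathematicalPhysics.QuantumFieldTheory.Balaban1983to89.FlowStep (ofMarkov)
open Literature.MathematicalPhysics.QuantumFieldTheory.Balaban1983to89.T4CouplingMatching (ScaleShiftRate scaleShiftRate_ofMarkov_iff)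

namespace BlockCovariance

/-! ## §1 Character orthogonality on the momentum fibre -/

section Orthogonality
/-- [bookkeeping] `Re e(t) = cos(2πt)`. [folklore] -/
theorem e_re (t : ℝ) : (e t).re = Real.cos (2 * π * t) := by
  rw [Literature.Analysis.Fourier.TrigApprox.e, show (2 * π * Complex.I * t : ℂ) = ((2 * π * t : ℝ) : ℂ) * Complex.I by push_cast; ring,
    Complex.exp_ofReal_mul_I_re]

/-- [bookkeeping] `e(t) = 1 ↔ t ∈ ℤ`. [folklore] -/
theorem e_eq_one_iff (t : ℝ) : e t = 1 ↔ ∃ m : ℤ, t = m := by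
  rw [Literature.Analysis.Fourier.TrigApprox.e, Complex.exp_eq_one_iff]
  have h2pi : (2 * π * Complex.I : ℂ) ≠ 0 := by simp [Real.pi_ne_zero, Complex.I_ne_zero]
  constructor
  · rintro ⟨n, hn⟩
    refine ⟨n, ?_⟩
    have h : ((t : ℝ) : ℂ) = (n : ℂ) := by
      have h1 : (2 * π * Complex.I : ℂ) * t = (2 * π * Complex.I) * n := by rw [hn]; ring
      exact mul_left_cancel₀ h2pi h1
    exact_mod_cast h
  · rintro ⟨m, rfl⟩
    exact ⟨m, by push_cast; ring⟩

/-- **ORTHOGONALITY OF THE FIBRE CHARACTERS**: `Σ_{j<K} e(j·n∕K) = K` if `K ∣ n`, `= 0` otherwise (`n ∈ ℤ`, `K ≥ 1`; geometric sum of a `K`-th root of unity). [folklore] -/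
theorem sum_e_fibre {K : ℕ} (hK : 0 < K) (n : ℤ) :
    ∑ j ∈ range K, e (j * ((n : ℝ) / K)) = if (K : ℤ) ∣ n then (K : ℂ) else 0 := by
  have hK' : (K : ℝ) ≠ 0 := by positivity
  simp_rw [e_nat_mul]
  split_ifs with hdiv
  · obtain ⟨c, hc⟩ := hdiv
    have h1 : e ((n : ℝ) / K) = 1 := by
      rw [e_eq_one_iff]
      exact ⟨c, by rw [hc]; push_cast; field_simp⟩
    simp [h1]
  · have hne : e ((n : ℝ) / K) ≠ 1 := by
      rw [Ne, e_eq_one_iff]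
      rintro ⟨m, hm⟩
      apply hdiv
      refine ⟨m, ?_⟩
      have : (n : ℝ) = K * m := by field_simp at hm; linarith
      exact_mod_cast this
    rw [geom_sum_eq hne, ← e_nat_mul, show ((K : ℕ) : ℝ) * ((n : ℝ) / K) = ((n : ℤ) : ℝ) by field_simp, e_int,
      sub_self, zero_div]

/-- THE FIBRE POINTS `t_j = x₀ + j∕(M+1)` (block size `K = M + 1`; fine momenta `p_j = 2πK·t_j = q + 2πj`). [folklore] -/
def tfib (M : ℕ) (x₀ : ℝ) (j : ℕ) : ℝ := x₀ + j / ((M : ℝ) + 1)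

/-- **THE COSINE FORM ON THE FIBRE**: `Σ_{j ≤ M} cos(2πn·t_j) = (M+1)·cos(2πn·x₀)` if `(M+1) ∣ n`, `= 0` otherwise (`n ∈ ℤ`). [folklore] -/
theorem sum_cos_tfib (M : ℕ) (x₀ : ℝ) (n : ℤ) :
    ∑ j ∈ range (M + 1), Real.cos (2 * π * n * tfib M x₀ j) =
      if ((M : ℤ) + 1) ∣ n then ((M : ℝ) + 1) * Real.cos (2 * π * n * x₀) else 0 := by
  have h : ∀ j : ℕ, Real.cos (2 * π * n * tfib M x₀ j) = (e (n * x₀) * e (j * ((n : ℝ) / (M + 1 : ℕ)))).re := by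
    intro j
    rw [← e_add, e_re, tfib]
    congr 1; push_cast; ring
  simp_rw [h]
  rw [← Complex.re_sum, ← mul_sum, sum_e_fibre (Nat.succ_pos M) n]
  push_cast
  split_ifs
  · simp [Complex.mul_re, e_re, mul_comm, mul_assoc]
  · simp
end Orthogonality

/-! ## §2 The fourth moment of the Fejér kernel over the momentum fibre -/

section FourthMoment
/-- [bookkeeping] For `1 ≤ h, h′ ≤ M`: `(M+1) ∣ (h + h′) ↔ h + h′ = M + 1` (because `2 ≤ h + h′ ≤ 2M < 2(M+1)`). [folklore] -/
theorem dvd_add_iff {M h h' : ℕ} (hh : h ∈ Icc 1 M) (hh' : h' ∈ Icc 1 M) :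
    ((M : ℤ) + 1) ∣ ((h : ℤ) + h') ↔ h + h' = M + 1 := by
  rw [mem_Icc] at hh hh'
  constructor
  · rintro ⟨c, hc⟩
    have : c = 1 := by have hc1 : 0 < c := (by nlinarith); have hc2 : c < 2 := (by nlinarith); omega
    subst this; exact_mod_cast (by linarith : ((h : ℤ) + h') = M + 1)
  · exact fun he => ⟨1, by rw [mul_one]; exact_mod_cast he⟩

/-- [bookkeeping] For `1 ≤ h, h′ ≤ M`: `(M+1) ∣ (h − h′) ↔ h = h′` (because `|h − h′| ≤ M − 1`). [folklore] -/
theorem dvd_sub_iff {M h h' : ℕ} (hh : h ∈ Icc 1 M) (hh' : h' ∈ Icc 1 M) :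
    ((M : ℤ) + 1) ∣ ((h : ℤ) - h') ↔ h = h' := by
  rw [mem_Icc] at hh hh'
  constructor
  · rintro ⟨c, hc⟩
    have : c = 0 := by have hc1 : -1 < c := (by nlinarith); have hc2 : c < 1 := (by nlinarith); omega
    subst this; exact_mod_cast (by linarith : (h : ℤ) = h')
  · rintro rfl; exact ⟨0, by ring⟩

/-- **PRODUCT OF TWO FIBRE HARMONICS, SUMMED OVER THE FIBRE**: for `1 ≤ h, h′ ≤ M`,
`Σ_{j ≤ M} cos(2πh·t_j)·cos(2πh′·t_j) = ½·((M+1)·cos(2π(M+1)x₀)·[h + h′ = M+1] + (M+1)·[h = h′])` — only the ALIASED pair (`h + h′ = K`) and the DIAGONAL survive. [folklore] -/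
theorem sum_cos_mul_cos_tfib (M : ℕ) (x₀ : ℝ) {h h' : ℕ} (hh : h ∈ Icc 1 M) (hh' : h' ∈ Icc 1 M) :
    ∑ j ∈ range (M + 1), Real.cos (2 * π * h * tfib M x₀ j) * Real.cos (2 * π * h' * tfib M x₀ j) =
      ((if h + h' = M + 1 then ((M : ℝ) + 1) * Real.cos (2 * π * ((M : ℝ) + 1) * x₀) else 0) +
        (if h = h' then ((M : ℝ) + 1) else 0)) / 2 := by
  have hprod : ∀ t : ℝ, Real.cos (2 * π * h * t) * Real.cos (2 * π * h' * t) =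
      (Real.cos (2 * π * (((h : ℤ) + h' : ℤ) : ℝ) * t) + Real.cos (2 * π * (((h : ℤ) - h' : ℤ) : ℝ) * t)) / 2 := by
    intro t
    push_cast
    rw [show 2 * π * ((h : ℝ) + h') * t = 2 * π * h * t + 2 * π * h' * t by ring,
      show 2 * π * ((h : ℝ) - h') * t = 2 * π * h * t - 2 * π * h' * t by ring, Real.cos_add, Real.cos_sub]
    ring
  simp_rw [hprod]
  rw [← sum_div, sum_add_distrib, sum_cos_tfib, sum_cos_tfib]
  congr 1
  congr 1
  · by_cases hs : h + h' = M + 1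
    · rw [if_pos ((dvd_add_iff hh hh').2 hs), if_pos hs]
      congr 2
      push_cast
      rw [show ((h : ℝ) + h') = (M : ℝ) + 1 by exact_mod_cast hs]
    · rw [if_neg (fun hd => hs ((dvd_add_iff hh hh').1 hd)), if_neg hs]
  · by_cases hd : h = h'
    · subst hd
      rw [if_pos ⟨0, by ring⟩, if_pos rfl]
      push_cast
      simp
    · rw [if_neg (fun hdv => hd ((dvd_sub_iff hh hh').1 hdv)), if_neg hd]

/-- [bookkeeping] A single fibre harmonic sums to zero: `Σ_{j ≤ M} cos(2πh·t_j) = 0` for `1 ≤ h ≤ M`. [folklore] -/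
theorem sum_cos_tfib_eq_zero (M : ℕ) (x₀ : ℝ) {h : ℕ} (hh : h ∈ Icc 1 M) :
    ∑ j ∈ range (M + 1), Real.cos (2 * π * h * tfib M x₀ j) = 0 := by
  have h1 := sum_cos_tfib M x₀ (h : ℤ)
  push_cast at h1
  rw [h1, if_neg]
  rw [mem_Icc] at hh
  rintro ⟨c, hc⟩
  have hc1 : 0 < c := by nlinarith
  have hc2 : c < 1 := by nlinarith
  omega

/-- [bookkeeping] The two weighted sums of the Fejér coefficients `w_h = M + 1 − h`: `Σ_{h=1}^{M} w_h·h = M(M+1)(M+2)∕6`, `Σ_{h=1}^{M} w_h² = M(M+1)(2M+1)∕6`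
(from the power sums `Σ h = M(M+1)∕2`, `Σ h² = M(M+1)(2M+1)∕6`). [folklore] -/
theorem sum_fejerWeights (M : ℕ) :
    (∑ h ∈ Icc 1 M, ((M : ℝ) + 1 - h) * h) = (M : ℝ) * (M + 1) * (M + 2) / 6 ∧
      (∑ h ∈ Icc 1 M, ((M : ℝ) + 1 - h) ^ 2) = (M : ℝ) * (M + 1) * (2 * M + 1) / 6 := by
  have hps : ∀ N : ℕ, (∑ h ∈ Icc 1 N, (h : ℝ)) = (N : ℝ) * (N + 1) / 2 ∧ (∑ h ∈ Icc 1 N, (h : ℝ) ^ 2) = (N : ℝ) * (N + 1) * (2 * N + 1) / 6 := by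
    intro N
    induction N with
    | zero => simp
    | succ N ih =>
      rw [sum_Icc_succ_top (by omega : 1 ≤ N + 1), sum_Icc_succ_top (by omega : 1 ≤ N + 1), ih.1, ih.2]
      constructor <;> (push_cast; ring)
  obtain ⟨h1, h2⟩ := hps M
  have e1 : ∑ h ∈ Icc 1 M, ((M : ℝ) + 1 - h) * h = ((M : ℝ) + 1) * ∑ h ∈ Icc 1 M, (h : ℝ) - ∑ h ∈ Icc 1 M, (h : ℝ) ^ 2 := by
    rw [mul_sum, ← sum_sub_distrib]; exact sum_congr rfl fun h _ => by ring
  have e2 : ∑ h ∈ Icc 1 M, ((M : ℝ) + 1 - h) ^ 2 =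
      ∑ h ∈ Icc 1 M, ((M : ℝ) + 1) ^ 2 - 2 * ((M : ℝ) + 1) * ∑ h ∈ Icc 1 M, (h : ℝ) + ∑ h ∈ Icc 1 M, (h : ℝ) ^ 2 := by
    rw [mul_sum, ← sum_sub_distrib, ← sum_add_distrib]; exact sum_congr rfl fun h _ => by ring
  rw [e1, e2, h1, h2, sum_const, Nat.card_Icc, nsmul_eq_mul]
  push_cast
  constructor <;> ring

/-- **THE FOURTH MOMENT OF THE FEJÉR KERNEL OVER THE MOMENTUM FIBRE**:
`Σ_{j ≤ M} F_M(x₀ + j∕(M+1))² = (M+1) + (M∕3)·((2M+1) + (M+2)·cos(2π(M+1)x₀))`.  Proof: `F_M = 1 + (2∕K)Σ_h w_h cos(2πh·)` (`fejer_eq`), the linear term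
dies on the fibre (`sum_cos_tfib_eq_zero`), the quadratic term keeps only the diagonal `h = h′` and the aliased pairs `h + h′ = K` (`sum_cos_mul_cos_tfib`), and the two surviving
weight sums are `sum_fejerWeights`. [folklore] -/
theorem sum_fejer_sq_fibre (M : ℕ) (x₀ : ℝ) :
    ∑ j ∈ range (M + 1), fejer M (tfib M x₀ j) ^ 2 =
      ((M : ℝ) + 1) + (M : ℝ) / 3 * ((2 * M + 1) + (M + 2) * Real.cos (2 * π * ((M : ℝ) + 1) * x₀)) := by
  set K : ℝ := (M : ℝ) + 1 with hKdef
  have hK : K ≠ 0 := by positivity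
  set cq : ℝ := Real.cos (2 * π * K * x₀) with hcq
  set w : ℕ → ℝ := fun h => K - h with hw
  set G : ℕ → ℝ := fun j => ∑ h ∈ Icc 1 M, w h * Real.cos (2 * π * h * tfib M x₀ j) with hG
  have hF : ∀ j, fejer M (tfib M x₀ j) = 1 + 2 / K * G j := fun j => fejer_eq M _
  -- the linear term vanishes on the fibre
  have hG1 : ∑ j ∈ range (M + 1), G j = 0 := by
    simp only [hG]
    rw [sum_comm]
    refine sum_eq_zero fun h hh => ?_
    rw [← mul_sum, sum_cos_tfib_eq_zero M x₀ hh, mul_zero]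
  -- the quadratic term: only the diagonal and the aliased pairs survive
  have hG2 : ∑ j ∈ range (M + 1), G j ^ 2 =
      K / 2 * (cq * ∑ h ∈ Icc 1 M, w h * h + ∑ h ∈ Icc 1 M, w h ^ 2) := by
    have step1 : ∀ j, G j ^ 2 = ∑ h ∈ Icc 1 M, ∑ h' ∈ Icc 1 M,
        w h * w h' * (Real.cos (2 * π * h * tfib M x₀ j) * Real.cos (2 * π * h' * tfib M x₀ j)) := by
      intro j
      rw [hG, sq, sum_mul_sum]
      exact sum_congr rfl fun h _ => sum_congr rfl fun h' _ => by ring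
    have step2 : ∑ j ∈ range (M + 1), G j ^ 2 = ∑ h ∈ Icc 1 M, ∑ h' ∈ Icc 1 M,
        w h * w h' * ∑ j ∈ range (M + 1), Real.cos (2 * π * h * tfib M x₀ j) * Real.cos (2 * π * h' * tfib M x₀ j) := by
      rw [sum_congr rfl fun j _ => step1 j, sum_comm]
      refine sum_congr rfl fun h _ => ?_
      rw [sum_comm]
      refine sum_congr rfl fun h' _ => ?_
      rw [mul_sum]
    rw [step2]
    have step3 : ∀ h ∈ Icc 1 M, ∑ h' ∈ Icc 1 M,
        w h * w h' * ∑ j ∈ range (M + 1), Real.cos (2 * π * h * tfib M x₀ j) * Real.cos (2 * π * h' * tfib M x₀ j) =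
          K / 2 * (cq * (w h * h) + w h ^ 2) := by
      intro h hh
      have hhM : h ≤ M + 1 := by rw [mem_Icc] at hh; omega
      have hmem : M + 1 - h ∈ Icc 1 M := by rw [mem_Icc] at hh ⊢; omega
      have e1 : ∀ h' ∈ Icc 1 M, w h * w h' * ∑ j ∈ range (M + 1), Real.cos (2 * π * h * tfib M x₀ j) * Real.cos (2 * π * h' * tfib M x₀ j)
          = (if h + h' = M + 1 then w h * w h' * (K * cq) / 2 else 0) + (if h = h' then w h * w h' * K / 2 else 0) := by
        intro h' hh'
        rw [sum_cos_mul_cos_tfib M x₀ hh hh']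
        split_ifs <;> ring
      rw [sum_congr rfl e1, sum_add_distrib, sum_ite_eq, if_pos hh,
        sum_eq_single (M + 1 - h) (fun b hb hne => if_neg (fun hb2 => hne (by omega))) (fun hn => absurd hmem hn),
        if_pos (by omega)]
      have hwsub : w (M + 1 - h) = h := by
        simp only [hw, hKdef]; push_cast [Nat.cast_sub hhM]; ring
      rw [hwsub]
      ring
    rw [sum_congr rfl step3, ← mul_sum, sum_add_distrib, ← mul_sum]
  -- assemble
  obtain ⟨hP, hQ⟩ := sum_fejerWeights M
  have hP' : ∑ h ∈ Icc 1 M, w h * h = (M : ℝ) * (M + 1) * (M + 2) / 6 := by simpa only [hw, hKdef] using hP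
  have hQ' : ∑ h ∈ Icc 1 M, w h ^ 2 = (M : ℝ) * (M + 1) * (2 * M + 1) / 6 := by simpa only [hw, hKdef] using hQ
  calc ∑ j ∈ range (M + 1), fejer M (tfib M x₀ j) ^ 2
      = ∑ j ∈ range (M + 1), (1 + 4 / K * G j + 4 / K ^ 2 * G j ^ 2) := sum_congr rfl fun j _ => by rw [hF]; ring
    _ = ((M : ℝ) + 1) + 4 / K * ∑ j ∈ range (M + 1), G j + 4 / K ^ 2 * ∑ j ∈ range (M + 1), G j ^ 2 := by
        rw [sum_add_distrib, sum_add_distrib, sum_const, card_range, ← mul_sum, ← mul_sum]; simp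
    _ = ((M : ℝ) + 1) + (M : ℝ) / 3 * ((2 * M + 1) + (M + 2) * cq) := by
        rw [hG1, hG2, hP', hQ']
        rw [hKdef]
        field_simp
        ring
end FourthMoment


/-! ## §3 The (R50) model on the axis: form factor, fine symbol, block covariance — closed form -/

section Model
/-- THE BLOCK FORM FACTOR `|u_j|² = F_M(t_j)∕(M+1)` of δ-block averaging over `M + 1` fine sites, at the `j`-th point of the momentum fibre (the (R50) engine's `a1[j]`
`= sin²(q∕2)∕(K² sin²(p_j∕2K))`, `formFactorSq_mul_sin_sq`).  MODEL object. [folklore] -/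
def formFactorSq (M : ℕ) (x₀ : ℝ) (j : ℕ) : ℝ := fejer M (tfib M x₀ j) / ((M : ℝ) + 1)

/-- THE FINE-LATTICE SYMBOL on the fibre: `D_j = 4K² sin²(p_j∕2K) = 4K² sin²(π t_j)` (the (R50) engine's `d1[j]`; (R58)'s `latSym K p_j`).  MODEL object. [folklore] -/
def fibreSym (M : ℕ) (x₀ : ℝ) (j : ℕ) : ℝ := 4 * ((M : ℝ) + 1) ^ 2 * Real.sin (π * tfib M x₀ j) ^ 2

/-- THE ON-AXIS BLOCK COVARIANCE `cB = Σ_{j ≤ M} |u_j|²∕D_j` of the δ-block-averaged massless free lattice field (the (R50) engine's `cB_m(q)` for `q` along a lattice axis, where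
the transverse fibre is trivial; block size `K = M + 1 = L^m`).  MODEL object; NOT Bałaban's propagator. [folklore] -/
def blockCov (M : ℕ) (x₀ : ℝ) : ℝ := ∑ j ∈ range (M + 1), formFactorSq M x₀ j / fibreSym M x₀ j

/-- **THE FORM FACTOR's CLOSED FORM** (the tree's `fejer_mul_sin_sq`): `|u_j|²·K²sin²(πt_j) = sin²(πK·x₀)` (`= sin²(q∕2)`, the same for every `j` on the fibre:
`sin²(πK x₀ + jπ) = sin²(πK x₀)`). [folklore] -/
theorem formFactorSq_mul_sin_sq (M : ℕ) (x₀ : ℝ) (j : ℕ) :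
    formFactorSq M x₀ j * (((M : ℝ) + 1) ^ 2 * Real.sin (π * tfib M x₀ j) ^ 2) = Real.sin (π * ((M : ℝ) + 1) * x₀) ^ 2 := by
  have h := fejer_mul_sin_sq M (tfib M x₀ j)
  have hK : (M : ℝ) + 1 ≠ 0 := by positivity
  have harg : π * ((M : ℝ) + 1) * tfib M x₀ j = π * ((M : ℝ) + 1) * x₀ + j * π := by
    rw [tfib]; field_simp
  rw [harg, Real.sin_add_nat_mul_pi] at h
  rw [formFactorSq]
  calc fejer M (tfib M x₀ j) / ((M : ℝ) + 1) * (((M : ℝ) + 1) ^ 2 * Real.sin (π * tfib M x₀ j) ^ 2)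
      = fejer M (tfib M x₀ j) * ((M : ℝ) + 1) * Real.sin (π * tfib M x₀ j) ^ 2 := by field_simp
    _ = ((-1) ^ j * Real.sin (π * ((M : ℝ) + 1) * x₀)) ^ 2 := h
    _ = Real.sin (π * ((M : ℝ) + 1) * x₀) ^ 2 := by rw [mul_pow, ← pow_mul, mul_comm j 2, pow_mul, neg_one_sq, one_pow, one_mul]

/-- **THE CLOSED FORM OF THE BLOCK COVARIANCE**: for `sin(πK·x₀) ≠ 0` (unit momentum `q = 2πK x₀ ∉ 2πℤ`),
`cB = (2 + cos q)∕(12 sin²(q∕2)) + 1∕(6K²)` with `q = 2πKx₀`, `K = M + 1` — by `formFactorSq_mul_sin_sq` (`|u_j|²∕D_j = |u_j|⁴∕(4 sin²(q∕2))`), the fourth moment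
`sum_fejer_sq_fibre` and `1 − cos q = 2 sin²(q∕2)`.  The `K`-DEPENDENCE IS EXACTLY `1∕(6K²)`. [folklore] -/
theorem blockCov_eq (M : ℕ) {x₀ : ℝ} (hx : Real.sin (π * ((M : ℝ) + 1) * x₀) ≠ 0) :
    blockCov M x₀ = (2 + Real.cos (2 * π * ((M : ℝ) + 1) * x₀)) / (12 * Real.sin (π * ((M : ℝ) + 1) * x₀) ^ 2)
      + 1 / (6 * ((M : ℝ) + 1) ^ 2) := by
  set K : ℝ := (M : ℝ) + 1 with hKdef
  have hK : K ≠ 0 := by positivity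
  set S : ℝ := Real.sin (π * K * x₀) ^ 2 with hS
  have hS0 : S ≠ 0 := pow_ne_zero 2 hx
  -- each term equals |u_j|⁴ / (4 sin²(q/2))
  have hterm : ∀ j, formFactorSq M x₀ j / fibreSym M x₀ j = formFactorSq M x₀ j ^ 2 / (4 * S) := by
    intro j
    have hmul := formFactorSq_mul_sin_sq M x₀ j
    have ha : formFactorSq M x₀ j ≠ 0 := by
      intro h0; rw [h0, zero_mul] at hmul; exact hS0 hmul.symm
    rw [fibreSym, show 4 * ((M : ℝ) + 1) ^ 2 * Real.sin (π * tfib M x₀ j) ^ 2 = 4 * (((M : ℝ) + 1) ^ 2 * Real.sin (π * tfib M x₀ j) ^ 2) by ring,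
      show ((M : ℝ) + 1) ^ 2 * Real.sin (π * tfib M x₀ j) ^ 2 = S / formFactorSq M x₀ j from by rw [eq_div_iff ha, mul_comm]; exact hmul]
    field_simp
  have hsq : ∀ j, formFactorSq M x₀ j ^ 2 = fejer M (tfib M x₀ j) ^ 2 / K ^ 2 := by
    intro j; rw [formFactorSq, div_pow]
  rw [blockCov, sum_congr rfl fun j _ => hterm j, ← sum_div, sum_congr rfl fun j _ => hsq j, ← sum_div, sum_fejer_sq_fibre]
  have hcos : Real.cos (2 * π * K * x₀) = 1 - 2 * S := by
    rw [hS, show 2 * π * K * x₀ = 2 * (π * K * x₀) by ring, Real.cos_two_mul, ← Real.sin_sq_add_cos_sq (π * K * x₀)]; ring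
  rw [hcos]
  rw [hKdef] at hK ⊢
  field_simp
  ring
end Model

/-! ## §4 The rate: at block size `L^m` the cutoff-dependence is EXACTLY `(L⁻²)^m∕6` -/

section Rate
/-- THE (R50) OBJECT INDEXED BY THE RENORMALIZATION STEP: block size `K = L^m` (i.e. `M = L^m − 1`), unit momentum `q` along the axis (`x₀ = q∕(2πL^m)`). [folklore] -/
def blockCovScale (L m : ℕ) (q : ℝ) : ℝ := blockCov (L ^ m - 1) (q / (2 * π * (L : ℝ) ^ m))

/-- **THE CLOSED FORM AT STEP `m`**: for `1 ≤ L` and `sin(q∕2) ≠ 0`,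
`cB_m(q) = (2 + cos q)∕(12 sin²(q∕2)) + (L⁻²)^m∕6`. [folklore] -/
theorem blockCovScale_eq {L : ℕ} (hL : 1 ≤ L) (m : ℕ) {q : ℝ} (hq : Real.sin (q / 2) ≠ 0) :
    blockCovScale L m q = (2 + Real.cos q) / (12 * Real.sin (q / 2) ^ 2) + ((L : ℝ)⁻¹ ^ 2) ^ m / 6 := by
  have hK : (((L ^ m - 1 : ℕ) : ℝ) + 1) = (L : ℝ) ^ m := by
    rw [Nat.cast_sub (Nat.one_le_pow m L hL)]; push_cast; ring
  have hLm : (L : ℝ) ^ m ≠ 0 := pow_ne_zero m (by exact_mod_cast (by omega : L ≠ 0))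
  have harg : π * (((L ^ m - 1 : ℕ) : ℝ) + 1) * (q / (2 * π * (L : ℝ) ^ m)) = q / 2 := by
    rw [hK]; field_simp
  have harg2 : 2 * π * (((L ^ m - 1 : ℕ) : ℝ) + 1) * (q / (2 * π * (L : ℝ) ^ m)) = q := by
    rw [hK]; field_simp
  have hx : Real.sin (π * (((L ^ m - 1 : ℕ) : ℝ) + 1) * (q / (2 * π * (L : ℝ) ^ m))) ≠ 0 := by rwa [harg]
  have hpow : ((L : ℝ)⁻¹ ^ 2) ^ m = (((L : ℝ) ^ m) ^ 2)⁻¹ := by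
    rw [← pow_mul, ← pow_mul, mul_comm 2 m, inv_pow]
  rw [blockCovScale, blockCov_eq _ hx, harg, harg2, hK, hpow]
  field_simp

/-- **THE STEP IS EXACTLY GEOMETRIC**: `cB_{m+1}(q) − cB_m(q) = −((1 − L⁻²)∕6)·(L⁻²)^m` — INDEPENDENT of `q` (`1 ≤ L`, `sin(q∕2) ≠ 0`). [folklore] -/
theorem blockCovScale_step {L : ℕ} (hL : 1 ≤ L) (m : ℕ) {q : ℝ} (hq : Real.sin (q / 2) ≠ 0) :
    blockCovScale L (m + 1) q - blockCovScale L m q = -((1 - (L : ℝ)⁻¹ ^ 2) / 6) * ((L : ℝ)⁻¹ ^ 2) ^ m := by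
  rw [blockCovScale_eq hL (m + 1) hq, blockCovScale_eq hL m hq, pow_succ]
  ring

/-- **(R50)'s MEASURED RATE, PROVED**: `|cB_{m+1}(q) − cB_m(q)| = ((1 − L⁻²)∕6)·(L⁻²)^m` for every `q` with `sin(q∕2) ≠ 0` (`1 ≤ L`) — rate `θ = L⁻²` EXACTLY, constant `(1 − L⁻²)∕6`.
[folklore] -/
theorem abs_blockCovScale_step {L : ℕ} (hL : 1 ≤ L) (m : ℕ) {q : ℝ} (hq : Real.sin (q / 2) ≠ 0) :
    |blockCovScale L (m + 1) q - blockCovScale L m q| = (1 - (L : ℝ)⁻¹ ^ 2) / 6 * ((L : ℝ)⁻¹ ^ 2) ^ m := by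
  have hL1 : (1 : ℝ) ≤ L := by exact_mod_cast hL
  have hinv : (L : ℝ)⁻¹ ^ 2 ≤ 1 := by
    have h0 : 0 ≤ (L : ℝ)⁻¹ := inv_nonneg.2 (by linarith)
    have h1 : (L : ℝ)⁻¹ ≤ 1 := inv_le_one_of_one_le₀ hL1
    nlinarith
  rw [blockCovScale_step hL m hq, abs_mul, abs_neg, abs_of_nonneg (by linarith : (0 : ℝ) ≤ (1 - (L : ℝ)⁻¹ ^ 2) / 6),
    abs_of_nonneg (by positivity)]

/-- **THE NUMBER OF GENERATION 12**: at `L = 2`, `|cB_{m+1}(q) − cB_m(q)| = (1∕8)·(1∕4)^m = 2^{−3−2m}` — the (R50) table's `r^B_m = 1.25e−1, 3.125e−2, 7.8125e−3, …`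
(`sin(q∕2) ≠ 0`). [folklore] -/
theorem abs_blockCovScale_step_two (m : ℕ) {q : ℝ} (hq : Real.sin (q / 2) ≠ 0) :
    |blockCovScale 2 (m + 1) q - blockCovScale 2 m q| = 1 / 8 * (1 / 4) ^ m := by
  rw [abs_blockCovScale_step (by norm_num) m hq]
  norm_num

/-- **VERBATIM THE β SUB-CELL's (AF-0r) FIELD SHAPE** (`Beta.Assembly.LimitForm.conv : ∀ k, |S.β0 k − binf| ≤ c₀ * θ ^ k`) for the sequence `k ↦ cB_k(q)`: limit
`(2 + cos q)∕(12 sin²(q∕2))`, `c₀ = 1∕6`, `θ = L⁻²` — with EQUALITY `|cB_k − binf| = (L⁻²)^k∕6` (`2 ≤ L`, `sin(q∕2) ≠ 0`).  MODEL instance; NOT Bałaban's `β⁰`. [folklore] -/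
theorem conv_shape_blockCov {L : ℕ} (hL : 2 ≤ L) {q : ℝ} (hq : Real.sin (q / 2) ≠ 0) :
    ∃ binf c₀ θ : ℝ, 0 ≤ c₀ ∧ 0 ≤ θ ∧ θ < 1 ∧ ∀ k, |blockCovScale L k q - binf| = c₀ * θ ^ k := by
  have hL1 : (1 : ℝ) < L := by exact_mod_cast hL
  refine ⟨(2 + Real.cos q) / (12 * Real.sin (q / 2) ^ 2), 1 / 6, (L : ℝ)⁻¹ ^ 2, by norm_num, by positivity, ?_, fun k => ?_⟩
  · have h1 : (L : ℝ)⁻¹ < 1 := inv_lt_one_of_one_lt₀ hL1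
    have h0 : 0 ≤ (L : ℝ)⁻¹ := inv_nonneg.2 (by linarith)
    nlinarith
  · rw [blockCovScale_eq (by omega) k hq, add_sub_cancel_left, abs_of_nonneg (by positivity)]
    ring

/-- **NE4's OWN SHAPE FOR THE BLOCK-COVARIANCE FAMILY**: the history-free family `β_{k+1}(…) := cB_{k+1}(q)` satisfies
`T4CouplingMatching.ScaleShiftRate ((1 − L⁻²)∕6 · L⁻²) (L⁻²) γ (ofMarkov …)` for every box `γ` (`1 ≤ L`, `sin(q∕2) ≠ 0`), with equality in the defining bound.  MODEL instance
of the shape at `θ = L⁻²`; NOT Bałaban's β. [folklore] -/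
theorem scaleShiftRate_blockCov {L : ℕ} (hL : 1 ≤ L) {q : ℝ} (hq : Real.sin (q / 2) ≠ 0) (γ : ℝ) :
    ScaleShiftRate ((1 - (L : ℝ)⁻¹ ^ 2) / 6 * (L : ℝ)⁻¹ ^ 2) ((L : ℝ)⁻¹ ^ 2) γ (ofMarkov fun k _ => blockCovScale L k q) := by
  rw [scaleShiftRate_ofMarkov_iff]
  intro k g _ _
  rw [show k + 2 = k + 1 + 1 from rfl, abs_blockCovScale_step hL (k + 1) hq, pow_succ]
  ring_nf
  rfl
end Rate

end BlockCovariance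

end Summit.QuantumFields.BalabanUV.T4Continuum.Spine.NE4
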